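import Summits.HodgeConjecture.HodgeConjecture.Theorems.F0P3cStCharTSWeylHypJacobianModelDock   -- ★ p851953 (this seat) (J6) «MODEL DOCK» `tubeJacobianLocal_of_modelPackage`; brings ★ (J6) FILE 1, ★ (J1), ★ (J6-T), ★ p851645
import Literature.NumberTheory.Automorphic.UnitaryGroupRankOneIwahoriDatum                     -- ★ (F0P3-p01) `exists_comap_congruenceGL_pow_subset` (the levels `K_{γ₀^{j+1}} ∩ U′` are a basis of `𝓝 1`); brings ★ `isCompact_isOpen_comap_congruenceGL`, `congruenceGL_mono`
import Mathlib.GroupTheory.ArchimedeanDensely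
import HarnessLib

/-!
# F0 · P3c · line LH6 «StCharTS» — ROAD «JAC-LOC» brick (J6) «ASSEMBLY → hJacLoc», FILE 3 «UNIFORM DOCK»: the CM socket of ★ p851645 from a UNIFORM per-level
# orbit-tube + mass package on the one-place model near each regular point, along the geometric level basis `K_{θ^{n+1}}` (Harish-Chandra 1970 L. 22)

Cell `pub/hodgecm-mathlib`, crux H413 = `stmt-HodgeConjecture-24833` (lane `--supports`, helper); seat LH6-p04 (g6); (J6) ED. 3-frame of LH6-p03 (g5)'s ROAD «JAC-LOC» (memo
`F0/P3b/LH6-p03/g5/ROAD-JAC-LOC.v3.LH6p03g5.md` §5–§6; docking notes F0∕P3b 2026-09-02T15:57:52Z).  THEOREMS ONLY; sorry-free; no definition ∕ instance ∕ notation; axioms TRIO.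
HONEST LABEL: count-neutral, closes no organ; HC_CM is proved only modulo the 7 printed citations (2 remaining: hLiu418 = `stmt-HodgeConjecture-24832`, h413 =
`stmt-HodgeConjecture-24833`) until rung 0 closes.

WHAT.  ★ MODEL DOCK asks for a model level basis `K′ : ℕ → Subgroup U′` and a per-coset package `hpkg`.  This file FIXES the basis to the geometric congruence levels
`K′ n := K_{θ^{n+1}} ∩ U′` (`0 ≠ θ < 1` in the value group of `L_w`; compact open ★ `isCompact_isOpen_comap_congruenceGL`, antitone ★ `congruenceGL_mono`, basis ★
`exists_comap_congruenceGL_pow_subset`) and reduces `hpkg` to TWO inputs stated at the torus POINT (not per coset): (i) `hDlc` — the weight `D` is locally constant at every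
regular `t₀` (★ (J6-D) `F0P3cStCharTSWeightLocConst` for `D = (Re Δ)²` ∕ the twist product); (ii) `hunif` — at every regular `t₀` an open `U ∋ t₀` and a level bound `γ₀ ≠ 0`
such that for EVERY `s ∈ U` and EVERY level `0 ≠ γ ≤ γ₀` the model carries a subgroup `P′` with the ORBIT-TUBE identity at `(K_γ, e s)` and the MASS identity `ν′(P′) =
D(s)·ν′(K_γ)` — which is ★ (J6-M) `orbit_and_mass_of_small_level` + `exists_small_level_bound` (LH6-p03) read at the model writing of `e s` ((J6-W)) with the constant
identified by (T4)∕★ (J7), the sizes being constant on `U` by ★ (J6-D).  OUTPUT: the `hJacLoc` clause of ★ p851645 VERBATIM (then «radial = D·tm on `T^{reg}`»).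
PROOF: `n₀` with `θ^{n₀+1} ≤ γ₀` (Mathlib `exists_pow_lt₀`, the value group being `MulArchimedean` ★ `ValuativeRel.isRankLeOne_iff_mulArchimedean`); a coset `s·T_n ⊆ U`
contains `s`; feed ★ `tubeJacobianLocal_of_modelPackage`.

## References
* [HarishChandra1970] Harish-Chandra, *Harmonic analysis on reductive p-adic groups*, LNM 162 (1970), Lemma 22, Lemma 42.
* [Rogawski1990] J. D. Rogawski, *Automorphic Representations of Unitary Groups in Three Variables*, Ann. of Math. Stud. 123 (1990), §12.5 p. 182.
* [Casselman1995] W. Casselman, *Introduction to the theory of admissible representations of p-adic reductive groups* (1995), §1.4 Prop. 1.4.4 (congruence bases).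
-/

set_option autoImplicit false
set_option linter.dupNamespace false

noncomputable section

open MeasureTheory Measure Set Filter Topology Function NumberField IsDedekindDomain Matrix Polynomial
open Literature.MeasureTheory.Group
open Literature.NumberTheory Literature.NumberTheory.Automorphic Literature.NumberTheory.Automorphic.UnitaryGroup Literature.NumberTheory.Rogawski1990
open Summit.HodgeConjecture.HodgeConjecture.Cruxes.H413.F0P3cStCharTSWeylHypJacobianModelDock
open Summit.HodgeConjecture.HodgeConjecture.Cruxes.H413.F0P3cStCharTSTubeModelTransport
open scoped ENNReal NNReal MatrixGroups Pointwise

namespace Summit.HodgeConjecture.HodgeConjecture.Cruxes.H413.F0P3cStCharTSWeylHypJacobianUniformDock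

section CM

variable (L : Type) [Field L] [NumberField L] [IsCMField L] (v : HeightOneSpectrum (𝓞 ↥(maximalRealSubfield L)))

set_option maxHeartbeats 3200000 in
set_option synthInstance.maxHeartbeats 200000 in
-- same elaboration class as ★ MODEL DOCK
/-- **(J6) «UNIFORM DOCK»**: the local tube-Jacobian socket `hJacLoc` of ★ p851645 (VERBATIM) from (i) local constancy of the weight `D` at regular points and (ii) a
UNIFORM orbit-tube + mass package on the one-place model at every `s` near each regular `t₀` and every congruence level `0 ≠ γ ≤ γ₀(t₀)` — module docstring.
[cite: HarishChandra1970, Lemma 22; Lemma 42] [cite: Rogawski1990, §12.5 p. 182] [cite: Casselman1995, §1.4 Prop. 1.4.4] -/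
theorem tubeJacobianLocal_of_uniformPackage
    (hns : ∀ w : PlacesOver L v, IsCMField.complexConj L • w.1 = w.1)
    [MeasurableSpace ↥(unitaryGroupOfForm (conjLocal L (IsCMField.complexConj L) v) (cmLocalForm L 3 v))] [BorelSpace ↥(unitaryGroupOfForm (conjLocal L (IsCMField.complexConj L) v) (cmLocalForm L 3 v))] [LocallyCompactSpace ↥(unitaryGroupOfForm (conjLocal L (IsCMField.complexConj L) v) (cmLocalForm L 3 v))] [SecondCountableTopology ↥(unitaryGroupOfForm (conjLocal L (IsCMField.complexConj L) v) (cmLocalForm L 3 v))] [T2Space ↥(unitaryGroupOfForm (conjLocal L (IsCMField.complexConj L) v) (cmLocalForm L 3 v))]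
    [MeasurableSpace (↥(unitaryGroupOfForm (conjLocal L (IsCMField.complexConj L) v) (cmLocalForm L 3 v)) ⧸ (cmBorelTriple L 3 v).M)] [BorelSpace (↥(unitaryGroupOfForm (conjLocal L (IsCMField.complexConj L) v) (cmLocalForm L 3 v)) ⧸ (cmBorelTriple L 3 v).M)]
    (ν : Measure ↥(unitaryGroupOfForm (conjLocal L (IsCMField.complexConj L) v) (cmLocalForm L 3 v))) [ν.IsHaarMeasure] [ν.IsMulRightInvariant]
    (tm : Measure ↥(cmBorelTriple L 3 v).M) [tm.IsMulLeftInvariant] [IsFiniteMeasureOnCompacts tm] [tm.IsOpenPosMeasure] [tm.IsInvInvariant]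
    (Φ : (↥(unitaryGroupOfForm (conjLocal L (IsCMField.complexConj L) v) (cmLocalForm L 3 v)) ⧸ (cmBorelTriple L 3 v).M) × ↥(cmBorelTriple L 3 v).M → ↥(unitaryGroupOfForm (conjLocal L (IsCMField.complexConj L) v) (cmLocalForm L 3 v))) (hΦ : ∀ (x : ↥(unitaryGroupOfForm (conjLocal L (IsCMField.complexConj L) v) (cmLocalForm L 3 v))) (t : ↥(cmBorelTriple L 3 v).M), Φ (QuotientGroup.mk x, t) = x * t * x⁻¹)
    (w : ↥(unitaryGroupOfForm (conjLocal L (IsCMField.complexConj L) v) (cmLocalForm L 3 v))) (hw : Units.val (w : GL (Fin 3) (LocalRing L v)) = cmLocalForm L 3 v)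
    (D : ↥(cmBorelTriple L 3 v).M → ℝ≥0)
    (w' : PlacesOver L v) (hw' : IsCMField.complexConj L • w'.1 = w'.1)
    [MeasurableSpace ↥(unitaryGroupOfForm (galAdicCompletionMap (L := L) (IsCMField.complexConj L) hw') (placeForm (Rogawski1990.qsForm L) w'.1))] [BorelSpace ↥(unitaryGroupOfForm (galAdicCompletionMap (L := L) (IsCMField.complexConj L) hw') (placeForm (Rogawski1990.qsForm L) w'.1))]
    (θ : ValuativeRel.ValueGroupWithZero (w'.1.adicCompletion L)) (hθ0 : θ ≠ 0) (hθ1 : θ < 1)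
    (hDlc : ∀ t₀ : ↥(cmBorelTriple L 3 v).M, IsRegularElt (((t₀ : ↥(unitaryGroupOfForm (conjLocal L (IsCMField.complexConj L) v) (cmLocalForm L 3 v)))) : GL (Fin 3) (LocalRing L v)) →
      ∃ U : Set ↥(cmBorelTriple L 3 v).M, IsOpen U ∧ t₀ ∈ U ∧ ∀ s ∈ U, D s = D t₀)
    (hunif : ∀ t₀ : ↥(cmBorelTriple L 3 v).M, IsRegularElt (((t₀ : ↥(unitaryGroupOfForm (conjLocal L (IsCMField.complexConj L) v) (cmLocalForm L 3 v)))) : GL (Fin 3) (LocalRing L v)) →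
      ∃ U : Set ↥(cmBorelTriple L 3 v).M, IsOpen U ∧ t₀ ∈ U ∧ ∃ γ₀ : ValuativeRel.ValueGroupWithZero (w'.1.adicCompletion L), γ₀ ≠ 0 ∧
        ∀ s ∈ U, ∀ γ : ValuativeRel.ValueGroupWithZero (w'.1.adicCompletion L), γ ≠ 0 → γ ≤ γ₀ →
          ∃ P' : Subgroup ↥(unitaryGroupOfForm (galAdicCompletionMap (L := L) (IsCMField.complexConj L) hw') (placeForm (Rogawski1990.qsForm L) w'.1)),
            {x' | ∃ k ∈ (((congruenceGL 3 (γ)).comap (unitaryGroupOfForm (galAdicCompletionMap (L := L) (IsCMField.complexConj L) hw') (placeForm (Rogawski1990.qsForm L) w'.1)).subtype : Subgroup ↥(unitaryGroupOfForm (galAdicCompletionMap (L := L) (IsCMField.complexConj L) hw') (placeForm (Rogawski1990.qsForm L) w'.1))) : Set ↥(unitaryGroupOfForm (galAdicCompletionMap (L := L) (IsCMField.complexConj L) hw') (placeForm (Rogawski1990.qsForm L) w'.1))), ∃ τ ∈ (((congruenceGL 3 (γ)).comap (unitaryGroupOfForm (galAdicCompletionMap (L := L) (IsCMField.complexConj L)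 hw') (placeForm (Rogawski1990.qsForm L) w'.1)).subtype : Subgroup ↥(unitaryGroupOfForm (galAdicCompletionMap (L := L) (IsCMField.complexConj L) hw') (placeForm (Rogawski1990.qsForm L) w'.1))) : Set ↥(unitaryGroupOfForm (galAdicCompletionMap (L := L) (IsCMField.complexConj L) hw') (placeForm (Rogawski1990.qsForm L) w'.1))),
                τ ∈ torusU (galAdicCompletionMap (L := L) (IsCMField.complexConj L) hw') (placeForm (Rogawski1990.qsForm L) w'.1) ∧
                  k * (localNonsplitEquiv (IsCMField.complexConj L) (Rogawski1990.qsForm L) (IsCMField.complexConj_ne_one L) w' hw') (s : ↥(unitaryGroupOfForm (conjLocal L (IsCMField.complexConj L) v) (cmLocalForm L 3 v))) * τ * k⁻¹ = x'} =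
              (localNonsplitEquiv (IsCMField.complexConj L) (Rogawski1990.qsForm L) (IsCMField.complexConj_ne_one L) w' hw') (s : ↥(unitaryGroupOfForm (conjLocal L (IsCMField.complexConj L) v) (cmLocalForm L 3 v))) • (P' : Set ↥(unitaryGroupOfForm (galAdicCompletionMap (L := L) (IsCMField.complexConj L) hw') (placeForm (Rogawski1990.qsForm L) w'.1))) ∧
            ∀ ν' : Measure ↥(unitaryGroupOfForm (galAdicCompletionMap (L := L) (IsCMField.complexConj L) hw') (placeForm (Rogawski1990.qsForm L) w'.1)), ν'.IsMulLeftInvariant →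
              ν' (P' : Set ↥(unitaryGroupOfForm (galAdicCompletionMap (L := L) (IsCMField.complexConj L) hw') (placeForm (Rogawski1990.qsForm L) w'.1))) = (D s : ℝ≥0∞) * ν' (((congruenceGL 3 (γ)).comap (unitaryGroupOfForm (galAdicCompletionMap (L := L) (IsCMField.complexConj L) hw') (placeForm (Rogawski1990.qsForm L) w'.1)).subtype : Subgroup ↥(unitaryGroupOfForm (galAdicCompletionMap (L := L) (IsCMField.complexConj L) hw') (placeForm (Rogawski1990.qsForm L) w'.1))) : Set ↥(unitaryGroupOfForm (galAdicCompletionMap (L := L) (IsCMField.complexConj L) hw') (placeForm (Rogawski1990.qsForm L) w'.1)))) :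
    ∀ t₀ : ↥(cmBorelTriple L 3 v).M, IsRegularElt (((t₀ : ↥(unitaryGroupOfForm (conjLocal L (IsCMField.complexConj L) v) (cmLocalForm L 3 v)))) : GL (Fin 3) (LocalRing L v)) →
      ∃ U : Set ↥(cmBorelTriple L 3 v).M, IsOpen U ∧ t₀ ∈ U ∧
        ∃ A₀ : Set (↥(unitaryGroupOfForm (conjLocal L (IsCMField.complexConj L) v) (cmLocalForm L 3 v)) ⧸ (cmBorelTriple L 3 v).M), MeasurableSet A₀ ∧ (quotientMeasure (cmBorelTriple L 3 v).M tm (isClosed_cmBorelTriple_M L v) ν) A₀ ≠ 0 ∧ (quotientMeasure (cmBorelTriple L 3 v).M tm (isClosed_cmBorelTriple_M L v) ν) A₀ ≠ ∞ ∧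
          ∀ V : Set ↥(cmBorelTriple L 3 v).M, MeasurableSet V → V ⊆ U → (∀ t ∈ V, IsRegularElt (((t : ↥(unitaryGroupOfForm (conjLocal L (IsCMField.complexConj L) v) (cmLocalForm L 3 v)))) : GL (Fin 3) (LocalRing L v))) →
            (∀ t ∈ V, ∀ t' ∈ V, ((t' : ↥(cmBorelTriple L 3 v).M) : ↥(unitaryGroupOfForm (conjLocal L (IsCMField.complexConj L) v) (cmLocalForm L 3 v))) ≠ w * t * w⁻¹) →
              ν (Φ '' (A₀ ×ˢ V)) = (quotientMeasure (cmBorelTriple L 3 v).M tm (isClosed_cmBorelTriple_M L v) ν) A₀ * ∫⁻ t in V, (D t : ℝ≥0∞) ∂tm := by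
  obtain ⟨-, -, hσc', -⟩ := model_pins L v w' hw'
  haveI : MulArchimedean (ValuativeRel.ValueGroupWithZero (w'.1.adicCompletion L)) :=
    ValuativeRel.isRankLeOne_iff_mulArchimedean.mp inferInstance
  have hθle1 : θ ≤ 1 := hθ1.le
  have hpow0 : ∀ n : ℕ, θ ^ (n + 1) ≠ 0 := fun n => pow_ne_zero _ hθ0
  -- the geometric level basis `K′ n := K_{θ^(n+1)} ∩ U′`
  refine tubeJacobianLocal_of_modelPackage L v hns ν tm Φ hΦ w hw D w' hw' (fun n => ((congruenceGL 3 (θ ^ (n + 1))).comap (unitaryGroupOfForm (galAdicCompletionMap (L := L) (IsCMField.complexConj L) hw') (placeForm (Rogawski1990.qsForm L) w'.1)).subtype : Subgroup ↥(unitaryGroupOfForm (galAdicCompletionMap (L := L) (IsCMField.complexConj L) hw') (placeForm (Rogawski1990.qsForm L) w'.1))))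
    (fun n => (isCompact_isOpen_comap_congruenceGL (galAdicCompletionMap (L := L) (IsCMField.complexConj L) hw')
      (J := placeForm (Rogawski1990.qsForm L) w'.1) hσc' (hpow0 n)).2)
    (fun n => (isCompact_isOpen_comap_congruenceGL (galAdicCompletionMap (L := L) (IsCMField.complexConj L) hw')
      (J := placeForm (Rogawski1990.qsForm L) w'.1) hσc' (hpow0 n)).1)
    (fun a b hab => Subgroup.comap_mono (congruenceGL_mono (pow_le_pow_right_of_le_one' hθle1 (Nat.succ_le_succ hab))))
    (fun W' hW' => exists_comap_congruenceGL_pow_subset (galAdicCompletionMap (L := L) (IsCMField.complexConj L) hw') hθ0 hθ1 hW')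
    fun t₀ ht₀ => ?_
  obtain ⟨U₁, hU₁o, ht₀U₁, hD⟩ := hDlc t₀ ht₀
  obtain ⟨U₂, hU₂o, ht₀U₂, γ₀, hγ₀0, hpk⟩ := hunif t₀ ht₀
  -- `θ^(n₀+1) ≤ γ₀`
  obtain ⟨n₀, hn₀⟩ := exists_pow_lt₀ hθ1 (Units.mk0 γ₀ hγ₀0)
  refine ⟨U₁ ∩ U₂, hU₁o.inter hU₂o, ⟨ht₀U₁, ht₀U₂⟩, fun s hs => hD s hs.1, n₀, fun n hn s hsU => ?_⟩
  have hsU : s ∈ U₁ ∩ U₂ := hsU (F0P3cStCharTSOpenCosetCover.mem_own_smul_coe _ s)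
  have hle : θ ^ (n + 1) ≤ γ₀ := by
    have h1 : θ ^ (n + 1) ≤ θ ^ n₀ := pow_le_pow_right_of_le_one' hθle1 (Nat.le_succ_of_le hn)
    exact h1.trans (by simpa using hn₀.le)
  exact hpk s hsU.2 (θ ^ (n + 1)) (hpow0 n) hle

end CM

end Summit.HodgeConjecture.HodgeConjecture.Cruxes.H413.F0P3cStCharTSWeylHypJacobianUniformDock

end
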